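import Literature.Topology.FourManifolds.MappingTorusProofs
import Mathlib.Topology.Homotopy.Lifting
import HarnessLib

/-!
# The covering `M × ℝ → T_φ` of a mapping torus; mapping tori are not simply connected

For the tree's mapping tori (`Literature/Topology/FourManifolds/MappingTorus.lean`: the
topological mapping torus `Literature.MappingTorus φ = M × ℝ / (x, t) ∼ (φ x, t + 1)` of a homeomorphism
and the relational smooth form `Literature.IsMappingTorusOf IT T φ`) we prove:

* `Literature.MappingTorus.Cover φ`: the type synonym `M × ℝ` carrying the **deck action** of `ℤ`,
  `k +ᵥ (x, t) = (φᵏ x, t + k)` (an `AddAction ℤ`);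
* `Literature.Topology.FourManifolds.MappingTorus.isAddQuotientCoveringMap_proj`: the quotient map `M × ℝ → T_φ` is a quotient
  covering map for this action (Mathlib's `IsAddQuotientCoveringMap`: the action is by
  homeomorphisms, its orbits are the fibres, and the slabs `M × (t - 1/2, t + 1/2)` are disjoint
  from their nonzero translates), in particular a covering map
  (`Literature.Topology.FourManifolds.MappingTorus.isCoveringMap_proj`);
* `Literature.Topology.FourManifolds.MappingTorus.not_simplyConnectedSpace`: if `M` is nonempty and path connected, `T_φ` is
  **not simply connected** — by Mathlib's monodromy theory
  (`IsQuotientCoveringMap.fundamentalGroupToMulOpposite_surjective`) the fundamental group of the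
  base of a quotient covering with path connected total space surjects onto the deck group, here
  `ℤ ≠ 0`;
* `Literature.Topology.FourManifolds.IsMappingTorusOf.not_simplyConnectedSpace`: the same for every smooth mapping torus `T` of
  a diffeomorphism of a nonempty path connected manifold (transport along the homeomorphism
  `T ≃ₜ MappingTorus φ`, `IsMappingTorusOf.nonempty_homeomorph_mappingTorus`, proved in
  `MappingTorusProofs.lean`).

Source: A. Hatcher, *Algebraic Topology* (2002), §1.3: Prop. 1.40 (the quotient map of a covering
space action `E → E/G` is a normal covering with deck group `G`, and `G ≅ π₁(E/G)/p_*π₁(E)` for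
path connected `E`) applied to Example 2.48 / §1.2 Ex. 11 (mapping tori); in particular
`π₁(T_φ) ↠ ℤ`, so `T_φ` is never simply connected. Hamilton's pieces `S³ × S¹` and `S³ ×~ S¹`
(R. Hamilton, *Four-manifolds with positive isotropic curvature*, Comm. Anal. Geom. 5 (1997),
Thm. 1.1, p. 2: "the product `S³ × S¹`, the twisted product `S³ ×~ S¹` which is the only unoriented
`S³` bundle over `S¹`") are the mapping tori of the identity and of a reflection of `S³`; this
file supplies "`π₁ ≠ 1`" for them in the derivation of Hamilton's Cor. 1.2(a)
(`Literature.Geometry.Riemannian.hamilton_pic_sphere_four`).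

## References

* A. Hatcher, *Algebraic Topology*, CUP (2002), §1.3 Prop. 1.40, Ch. 2 Example 2.48
  [HatcherAT2002].
* S. Cappell, J. Shaneson, *Some new four-manifolds*, Ann. of Math. 104 (1976), §1
  [CappellShaneson1976].
-/

open scoped Topology
open Set Function

noncomputable section

namespace Literature.Topology.FourManifolds

namespace MappingTorus

variable {M : Type*} [TopologicalSpace M] (φ : M ≃ₜ M)

/-! ### The deck action on `M × ℝ` -/

/-- The total space `M × ℝ` of the infinite cyclic covering of the mapping torus `T_φ`, as a type
synonym carrying the deck `ℤ`-action `k +ᵥ (x, t) = (φᵏ x, t + k)` (Hatcher, *Algebraic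
Topology*, §1.3, Example 2.48 and Prop. 1.40). [folklore] -/
def Cover (_φ : M ≃ₜ M) : Type _ := M × ℝ

/-- The product topology on the covering space `M × ℝ` (transported to the synonym). [folklore] -/
instance Cover.instTopologicalSpace : TopologicalSpace (Cover φ) :=
  inferInstanceAs (TopologicalSpace (M × ℝ))

/-- The identification of the covering space with `M × ℝ`. [folklore] -/
def Cover.mk (p : M × ℝ) : Cover φ := p

/-- The coordinates of a point of the covering space. [folklore] -/
def Cover.out (p : Cover φ) : M × ℝ := p

/-- `Cover.out ∘ Cover.mk = id`, definitionally. [folklore] -/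
@[simp] theorem Cover.out_mk (p : M × ℝ) : Cover.out φ (Cover.mk φ p) = p := rfl

/-- `Cover.mk ∘ Cover.out = id`, definitionally. [folklore] -/
@[simp] theorem Cover.mk_out (p : Cover φ) : Cover.mk φ (Cover.out φ p) = p := rfl

/-- `Cover.mk` is a homeomorphism `M × ℝ ≃ₜ Cover φ` (the identity). [folklore] -/
def Cover.homeomorph : M × ℝ ≃ₜ Cover φ where
  toFun := Cover.mk φ
  invFun := Cover.out φ
  left_inv _ := rfl
  right_inv _ := rfl
  continuous_toFun := continuous_id
  continuous_invFun := continuous_id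

/-- **The deck action** of `ℤ` on `M × ℝ`: `k +ᵥ (x, t) = (φᵏ x, t + k)`; these are exactly the
homeomorphisms of `M × ℝ` commuting with the projection to `T_φ` (Hatcher, *Algebraic Topology*,
§1.3, deck transformations; Example 2.48). [folklore] -/
instance Cover.instAddAction : AddAction ℤ (Cover φ) where
  vadd k p := Cover.mk φ ((φ.toEquiv ^ k) (Cover.out φ p).1, (Cover.out φ p).2 + (k : ℝ))
  zero_vadd p := by
    change Cover.mk φ ((φ.toEquiv ^ (0 : ℤ)) (Cover.out φ p).1, (Cover.out φ p).2 + ((0 : ℤ) : ℝ))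
      = p
    simp only [zpow_zero, Equiv.Perm.coe_one, id_eq, Int.cast_zero, add_zero]
    rfl
  add_vadd k l p := by
    change Cover.mk φ ((φ.toEquiv ^ (k + l)) (Cover.out φ p).1, (Cover.out φ p).2 + ((k + l : ℤ) : ℝ))
      = Cover.mk φ ((φ.toEquiv ^ k) ((φ.toEquiv ^ l) (Cover.out φ p).1),
          (Cover.out φ p).2 + ((l : ℤ) : ℝ) + ((k : ℤ) : ℝ))
    rw [zpow_add, Equiv.Perm.coe_mul, comp_apply, Int.cast_add]
    congr 1
    ext
    · rfl
    · show (Cover.out φ p).2 + ((k : ℝ) + (l : ℝ)) = (Cover.out φ p).2 + (l : ℝ) + (k : ℝ)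
      ring

/-- The deck action on coordinates: `k +ᵥ (x, t) = (φᵏ x, t + k)`. [folklore] -/
theorem Cover.out_vadd (k : ℤ) (p : Cover φ) :
    Cover.out φ (k +ᵥ p) = ((φ.toEquiv ^ k) (Cover.out φ p).1, (Cover.out φ p).2 + (k : ℝ)) :=
  rfl

/-- The deck transformations are continuous: the action of `ℤ` on `M × ℝ` is by homeomorphisms
(`MappingTorus.continuous_deck`). [folklore] -/
instance Cover.instContinuousConstVAdd : ContinuousConstVAdd ℤ (Cover φ) :=
  ⟨fun k => MappingTorus.continuous_deck φ k⟩

/-! ### The covering map -/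

/-- The projection `M × ℝ → T_φ`, `(x, t) ↦ [(x, t)]`, on the covering space
(Hatcher, *Algebraic Topology*, Example 2.48). [folklore] -/
def Cover.proj (p : Cover φ) : MappingTorus φ := MappingTorus.mk φ (Cover.out φ p).1 (Cover.out φ p).2

/-- `Cover.proj` on coordinates. [folklore] -/
@[simp] theorem Cover.proj_mk (p : M × ℝ) :
    Cover.proj φ (Cover.mk φ p) = MappingTorus.mk φ p.1 p.2 := rfl

/-- **`M × ℝ → T_φ` is a quotient covering map for the deck action of `ℤ`.** It is a quotient map
by construction; the action is by homeomorphisms; two points have the same image iff they lie in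
the same `ℤ`-orbit (`MappingTorus.mk_eq_mk_iff`); and the slab `{|t' - t| < 1/2}` around `(x, t)`
is disjoint from its translates by every `k ≠ 0`, since a translate shifts the `ℝ`-coordinate by
the integer `k` (Hatcher, *Algebraic Topology*, §1.3, Prop. 1.40 with Example 2.48).
[cite: HatcherAT2002, Prop. 1.40] -/
theorem isAddQuotientCoveringMap_proj : IsAddQuotientCoveringMap (Cover.proj φ) ℤ where
  toIsQuotientMap := MappingTorus.isQuotientMap_mk φ
  toContinuousConstVAdd := inferInstance
  apply_eq_iff_mem_orbit {p q} := by
    change MappingTorus.mk φ (Cover.out φ p).1 (Cover.out φ p).2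
        = MappingTorus.mk φ (Cover.out φ q).1 (Cover.out φ q).2 ↔ _
    rw [MappingTorus.mk_eq_mk_iff, AddAction.mem_orbit_iff]
    constructor
    · rintro ⟨k, hk, hy⟩
      refine ⟨-k, ?_⟩
      apply (Cover.homeomorph φ).symm.injective
      change Cover.out φ ((-k) +ᵥ q) = Cover.out φ p
      rw [Cover.out_vadd, hk, hy, ← Equiv.Perm.mul_apply, ← zpow_add, neg_add_cancel, zpow_zero,
        Equiv.Perm.one_apply, Int.cast_neg, add_neg_cancel_right]
    · rintro ⟨k, rfl⟩
      refine ⟨-k, ?_, ?_⟩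
      · rw [Cover.out_vadd, Int.cast_neg, add_neg_cancel_right]
      · rw [Cover.out_vadd, ← Equiv.Perm.mul_apply, ← zpow_add, neg_add_cancel, zpow_zero,
          Equiv.Perm.one_apply]
  disjoint p := by
    refine ⟨{q | |(Cover.out φ q).2 - (Cover.out φ p).2| < 2⁻¹}, ?_, ?_⟩
    · refine IsOpen.mem_nhds ?_ (by simp)
      have hc : Continuous fun q : Cover φ => |(Cover.out φ q).2 - (Cover.out φ p).2| :=
        ((continuous_snd : Continuous fun q : M × ℝ => q.2).sub continuous_const).abs
      exact isOpen_lt hc continuous_const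
    · rintro k ⟨_, ⟨q, hq, rfl⟩, hkq⟩
      simp only [mem_setOf_eq, Cover.out_vadd] at hq hkq
      have h1 : |(k : ℝ)| < 1 := by
        have := abs_sub_lt_iff.1 hq
        have := abs_sub_lt_iff.1 hkq
        rw [abs_lt]
        constructor <;> linarith [this.1, this.2]
      have hk1 : k < 1 := by exact_mod_cast (abs_lt.1 h1).2
      have hk2 : -1 < k := by exact_mod_cast (abs_lt.1 h1).1
      omega

/-- `M × ℝ → T_φ` is a covering map (Hatcher, *Algebraic Topology*, Prop. 1.40, Example 2.48).
[cite: HatcherAT2002, Prop. 1.40] -/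
theorem isCoveringMap_proj : IsCoveringMap (Cover.proj φ) :=
  (isAddQuotientCoveringMap_proj φ).toMultiplicative.isCoveringMap

/-- The covering space `M × ℝ` is path connected when `M` is. [folklore] -/
instance Cover.instPathConnectedSpace [PathConnectedSpace M] : PathConnectedSpace (Cover φ) :=
  inferInstanceAs (PathConnectedSpace (M × ℝ))

/-- The mapping torus of a homeomorphism of a path connected space is path connected (continuous
image of `M × ℝ`) (Hatcher, *Algebraic Topology*, Example 2.48). [folklore] -/
instance pathConnectedSpace [PathConnectedSpace M] : PathConnectedSpace (MappingTorus φ) :=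
  (MappingTorus.mk_surjective φ).pathConnectedSpace (MappingTorus.continuous_mk φ)

/-- **A mapping torus is not simply connected.** For a homeomorphism `φ` of a nonempty path
connected space `M`, `T_φ = M × ℝ / (x, t) ∼ (φ x, t + 1)` is not simply connected: `M × ℝ → T_φ`
is a quotient covering by the deck group `ℤ` with path connected total space, so by the monodromy
correspondence (`IsQuotientCoveringMap.fundamentalGroupToMulOpposite_surjective`) `π₁(T_φ)`
surjects onto `ℤ`, which is not trivial (Hatcher, *Algebraic Topology*, Prop. 1.40(c):
`G ≅ π₁(E/G)/p_*π₁(E)`; Example 2.48). [cite: HatcherAT2002, Prop. 1.40] -/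
theorem not_simplyConnectedSpace [Nonempty M] [PathConnectedSpace M] :
    ¬ SimplyConnectedSpace (MappingTorus φ) := by
  intro hsc
  have hcov := (isAddQuotientCoveringMap_proj φ).toMultiplicative
  let p₀ : Cover φ := Cover.mk φ (Classical.arbitrary M, 0)
  let e : Cover.proj φ ⁻¹' {Cover.proj φ p₀} := ⟨p₀, rfl⟩
  have hs := hcov.fundamentalGroupToMulOpposite_surjective e
  haveI : Subsingleton (Multiplicative ℤ)ᵐᵒᵖ := hs.subsingleton
  haveI : Subsingleton (Multiplicative ℤ) := MulOpposite.op_injective.subsingleton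
  have h01 : Multiplicative.ofAdd (0 : ℤ) = Multiplicative.ofAdd 1 := Subsingleton.elim _ _
  exact zero_ne_one (Multiplicative.ofAdd.injective h01)

end MappingTorus

/-! ### Smooth mapping tori -/

section Smooth

open scoped Manifold ContDiff

variable {E H : Type*} [NormedAddCommGroup E] [NormedSpace ℝ E] [TopologicalSpace H]
  {I : ModelWithCorners ℝ E H}
  {ET HT : Type*} [NormedAddCommGroup ET] [NormedSpace ℝ ET] [TopologicalSpace HT]
  {IT : ModelWithCorners ℝ ET HT}
  {M : Type*} [TopologicalSpace M] [ChartedSpace H M]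
  {T : Type*} [TopologicalSpace T] [ChartedSpace HT T]

/-- **A smooth mapping torus is not simply connected.** If the manifold `T` is a smooth mapping
torus (`IsMappingTorusOf IT T φ`) of a diffeomorphism `φ` of a nonempty path connected manifold
`M`, then `T` is not simply connected: `T ≃ₜ MappingTorus φ`
(`IsMappingTorusOf.nonempty_homeomorph_mappingTorus`) and `MappingTorus.not_simplyConnectedSpace`.
In particular `π₁(S³ × S¹) ≠ 1 ≠ π₁(S³ ×~ S¹)` for Hamilton's two `S³`-bundles over `S¹`, the
mapping tori of the identity and of a reflection of `S³` (Hamilton, Comm. Anal. Geom. 5 (1997),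
Thm. 1.1, p. 2) (Hatcher, *Algebraic Topology*, Prop. 1.40, Example 2.48).
[cite: HatcherAT2002, Prop. 1.40] -/
theorem IsMappingTorusOf.not_simplyConnectedSpace [Nonempty M] [PathConnectedSpace M]
    {φ : M ≃ₘ⟮I, I⟯ M} (h : IsMappingTorusOf IT T φ) : ¬ SimplyConnectedSpace T := by
  obtain ⟨e⟩ := h.nonempty_homeomorph_mappingTorus
  intro hT
  exact MappingTorus.not_simplyConnectedSpace φ.toHomeomorph e.symm.toHomotopyEquiv.simplyConnectedSpace

end Smooth

end Literature.Topology.FourManifolds
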